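import Mathlib.Analysis.SpecialFunctions.Complex.Log
import Literature.AnabelianGeometry.AbsoluteAnabelian.LogShellsOfUnitLog
import HarnessLib

/-!
# Joshi's log-shells I ([J-III] arXiv:2401.13508 v4, §9.1–§9.2): Bloch–Kato subspaces, Mochizuki's log-shell «from the point
# of view of [Joshi 2021a]» (Def. 9.2.1.1), Lemma 9.2.1.4, Prop. 9.2.1.5, adelic log-shells (9.2.2) — TYPED, no side taken

Record file of the abc-iut cell, branch E «type Joshi's construction, test vs S» (rung LADDER-ABC:A2.E; seat abc-iut-E-t19, slot
T-19; sequel `Joshi/LogShellBphiJoshi.lean` types §9.3). Source: K. Joshi, *Construction of Arithmetic Teichmuller Spaces III*,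
«Preliminary version for comments», arXiv:2401.13508 v4 = bib `Joshi2024ATS3` ("[J-III]"); «p. N l. a–b» = PDF page N (printed
page N − 1), lines of the render `HOME/lit/renders/Joshi-arxiv-2401.13508/pNNNN.txt`. UNREFEREED preprint, rejected by the IUT
author [Mochizuki2024JoshiReport]; everything is TYPED AS A CANDIDATE (D-0012): typed ≠ proved ≠ endorsed; nothing here asserts
abc, [IUTchIII] Cor. 3.12, or any claim of [J-III]. Joshi's ASSERTIONS are `def … : Prop` with `@[claim "Joshi2024ATS3" "disputed"]`;
the classical inputs he RECALLS ([BlochKato1990], Perrin-Riou 1994) are FIELDS of the signature `BlochKatoDatum` (cell rule: no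
new `Prop` facts); what FOLLOWS from a signature is a proved `theorem`.

* §9.1.1 (p. 94 l. 41 – p. 95 l. 52): `H¹(G_E, ℚ_p(1)) = Ext¹_{G_E}(ℚ_p(0), ℚ_p(1))` (9.1.1.1) with `H¹_e ⊆ H¹_f ⊆ H¹_st ⊆ H¹_g`,
  the decomposition (9.1.1.3) `H¹ ≃ H¹_f ⊕ ℚ_p ≃ E ⊕ ℚ_p`, «explicitly `q ↦ (log_E(q), v_E(q))`», and (9.1.1.4)
  `H¹_e = H¹_f ⊊ H¹_st = H¹_g = H¹` — SIGNATURE `BlochKatoDatum` (§1). DERIVED: the Kummer class of `q ∈ E^×` lies in `H¹_f`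
  iff `v_E(q) = 0` iff `‖q‖ = 1` (`kummer_mem_Hf_iff_norm`).
* §9.1.2 (p. 96 l. 6–30): `H¹(L_v, ℤ(1)) := Ext¹_{ℤ-MHS}(ℤ(0), ℤ(1)) ≃ ℂ^*` (9.1.2.1) and `H¹_e(ℂ, ℤ(1)) := {0 < |q|_ℂ ≤ 1}` (9.1.2.2)
  — DEFINED in the model `ℂ^* ⊂ ℂ` (`archH1`, `archH1e`; submonoid PROVED); «a Schottky parameter … lies in `H¹_e`» PROVED for
  `q = e^{2πiτ}`, `Im τ > 0` (`exp_two_pi_I_mul_mem_archH1e`).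
* Def. 9.2.1.1 (p. 96 l. 35–50): `I((X/L_v, X^an/K_v)) = (1/p)·log(𝒪^*_{L_v})` (`p ≥ 3`), `(1/4)·log(𝒪^*_{L_v})` (`p = 2`) — DEFINED
  verbatim by cases (`mochizukiLogShell`, `log(𝒪^*) = Literature.IUT.LogVolume.logUnits`) and PROVED EQUAL to OUR typed
  [AbsTopIII] Def. 5.4 (iii) / [IUTchIII] Prop. 1.2 (vi) model `logShell (PadicLogOnUnits.ofUnitLog p L_v) = (p*)⁻¹ • log_p(𝒪^×)`
  (`mochizukiLogShell_eq_logShell`) — THE E3 DICTIONARY ROW of this slot; `𝒪 ⊆ I`, `log(𝒪^×) ⊆ I` DERIVED. (9.2.1.3)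
  `I^{ℚ_p} := I ⊗_{ℤ_p} ℚ_p` MODELLED as the `ℚ_p`-span in `L_v` (`I` is a lattice), PROVED `= L_v` (`mochizukiLogShellQ_eq_top`).
* Lemma 9.2.1.4 (p. 96 l. 54 – p. 97 l. 3) «`I` is the mono-analytic log-shell [IUTchIII, Prop. 1.2 (vi)] given by `hol(X/L)_y`»:
  model level = `mochizukiLogShell_eq_logShell`; the binding to OUR frozen Thm. 3.11 signature `Thm311.LogShells.shell v`
  (dictionary row D-08) lives in `Joshi/DictionaryLogShells.lean` (binding-point rule R14: object files import no Cor312*/Thm311*).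
* Prop. 9.2.1.5 (p. 97 l. 6–35): (1)(2) amphoricity — `IsAmphoric`/`LogShellAmphoric` (the reading Rmk. 9.4.8.2 p. 105 l. 53–55
  uses: «abstract isomorphisms `I_{p,y_j} ≃ I_{p,y_ℓ*}`»); (3) `I = H¹_f(ℤ_p(1)) = H¹_e(ℤ_p(1))`, `I^{ℚ_p} = H¹_f(ℚ_p(1)) = H¹_e(ℚ_p(1))`
  — claim `LogShellIsBlochKato` (the `e = f` halves DERIVED); (4) docstring. RECORDED NEUTRALLY: under `q ↦ (log_E(q), v_E(q))`
  the classes of units map INTO `I` (`toE_kummer_mem_mochizukiLogShell`), and the rational half HOLDS in the model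
  (`Hf_map_toE_eq`); print fixes no finer normalisation. Rmk. 9.2.1.6: «[This proposition is not established in [Mochizuki
  2021a,b,c].]»; «`H¹_e` … stable under iterates of log-Links» ↔ OUR (Ind3) containments (`Thm311LogKummer`).
* Def. 9.2.2.1 / Prop. 9.2.2.4 (p. 98 l. 1–19): `∏_{v} I(hol(X/L_v)_{y_v})`, its rational version, and the identification (9.2.2.5)
  with the adelic cohomology of `arith(L)_y` — `adelicLogShell(Q)`, claim `AdelicLogShellIsBlochKato` (RENDER NOTE: the relation
  symbols of (9.2.2.5) are lost in the text layer, p. 98 l. 14–17; typed as the componentwise «identification» announced).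

E3 dictionary (nearest FQNs, bound only in `Joshi/Dictionary*.lean`): `I((X/L_v,X^an/K_v))` ↔ `AbsoluteAnabelian.logShell
(PadicLogOnUnits.ofUnitLog p L_v)` (Literature; PROVED equal here) and `Summit.ABC.IUTFork.Thm311.LogShells.shell v` (row D-08);
`I^{ℚ_p}` ↔ `Thm311.LogShells.carrier v`; the adelic product ↔ `Thm311.LogShells.Packet1` (sums over `v | v_ℚ` only). NOT here: `B_cris ⊂ B_st ⊂ B_dR`, Galois cohomology itself,
arithmeticoids [Joshi 2023a §7], any judgement. [claim: Joshi2024ATS3, status: disputed]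
-/

set_option autoImplicit false

noncomputable section

open Set Metric
open scoped Pointwise Real

namespace Summit.ABC.IUTFork.Joshi

open Literature.IUT.LogVolume Literature.AnabelianGeometry.AbsoluteAnabelian

/-! ## 1. §9.1.1 — Bloch–Kato subspaces of `H¹(G_E, ℚ_p(1))` (signature) -/

section BlochKato

variable (p : ℕ) [Fact p.Prime] (E : Type) [NontriviallyNormedField E] [NormedAlgebra ℚ_[p] E]
variable (H1 : Type) [AddCommGroup H1] [Module ℚ_[p] H1]

/-- **SIGNATURE `BlochKatoDatum`** ([J-III] §9.1.1, p. 94 l. 41 – p. 95 l. 52). For a `p`-adic field `E` (with a chosen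
algebraic closure; cohomology «depends on the choice of an arithmeticoid», p. 94 l. 31–32) the `ℚ_p`-space
`H1 = H¹(G_E, ℚ_p(1)) = Ext¹_{G_E}(ℚ_p(0), ℚ_p(1))` ((9.1.1.1), Perrin-Riou) with: the Bloch–Kato subspaces
`H¹_∗ := ker(H¹ → H¹(G_E, B_∗))`, `∗ ∈ {e, f, st, g}`, `B_∗ = B_cris^{φ=1}, B_cris, B_st, B_dR` (p. 95 l. 26–35; the period rings
are NOT typed — the kernels are primitive fields); the image `HZ` of `H¹(G_E, ℤ_p(1))` (for the «integral versions»
`H¹_∗(ℤ_p(1)) = H¹(ℤ_p(1)) ∩ H¹_∗(ℚ_p(1))`, p. 95 l. 36–39, READ inside `H¹(ℚ_p(1))`); the Kummer map `κ : E^× → H1`; (9.1.1.3)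
`H¹ ≃ H¹_f ⊕ ℚ_p ≃ E ⊕ ℚ_p`, «explicitly given as `q ↦ (log_E(q), v_E(q))`, so this isomorphism tracks the valuation of `q`
separately» (p. 95 l. 20–25; `log_E` = OUR `unitLog` on units, its value on non-units not fixed by print); (9.1.1.4)
`H¹_e = H¹_f ⊊ H¹_st = H¹_g = H¹` ([BlochKato1990]; «The first equality will play an important role», p. 95 l. 45–52).
HYPOTHESIS structure, never instantiated here. [claim: Joshi2024ATS3, status: disputed] -/
structure BlochKatoDatum where
  /-- `H¹_e(G_E, ℚ_p(1))` (crystalline Frobenius-trivial extensions), p. 95 l. 33–35 -/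
  He : Submodule ℚ_[p] H1
  /-- `H¹_f(G_E, ℚ_p(1))` (crystalline extensions), p. 95 l. 27–28 -/
  Hf : Submodule ℚ_[p] H1
  /-- `H¹_st(G_E, ℚ_p(1))` (semi-stable extensions), p. 95 l. 29–30 -/
  Hst : Submodule ℚ_[p] H1
  /-- `H¹_g(G_E, ℚ_p(1))` (de Rham extensions), p. 95 l. 31–32 -/
  Hg : Submodule ℚ_[p] H1
  /-- the image of `H¹(G_E, ℤ_p(1))` (integral classes), p. 95 l. 36–39 -/
  HZ : AddSubgroup H1
  /-- the Kummer map `κ : E^× → H¹(G_E, ℚ_p(1))`, p. 95 l. 24 -/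
  kummer : Eˣ → H1
  /-- `κ` is a homomorphism -/
  kummer_mul : ∀ a b : Eˣ, kummer (a * b) = kummer a + kummer b
  /-- Kummer classes are integral -/
  kummer_mem_HZ : ∀ q : Eˣ, kummer q ∈ HZ
  /-- the valuation `v_E : E^× → ℤ` of (9.1.1.3) -/
  val : Eˣ → ℤ
  /-- `v_E(q) = 0` exactly on `𝒪_E^× = {‖q‖ = 1}` -/
  val_eq_zero_iff : ∀ q : Eˣ, val q = 0 ↔ ‖(q : E)‖ = 1
  /-- the logarithm `log_E : E^× → E` of (9.1.1.3) -/
  logE : Eˣ → E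
  /-- on units, `log_E = log_p` (OUR `unitLog`) -/
  logE_of_norm_eq_one : ∀ q : Eˣ, ‖(q : E)‖ = 1 → logE q = unitLog (q : E)
  /-- (9.1.1.3): `H¹(G_E, ℚ_p(1)) ≃ H¹_f ⊕ ℚ_p ≃ E ⊕ ℚ_p`, p. 95 l. 20–23 -/
  dec : H1 ≃ₗ[ℚ_[p]] (E × ℚ_[p])
  /-- «explicitly given as `q ↦ (log_E(q), v_E(q))`», p. 95 l. 24–25 -/
  dec_kummer : ∀ q : Eˣ, dec (kummer q) = (logE q, ((val q : ℤ) : ℚ_[p]))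
  /-- under (9.1.1.3), `H¹_f = E ⊕ 0`, p. 95 l. 22–23 -/
  Hf_eq_ker : Hf = LinearMap.ker ((LinearMap.snd ℚ_[p] E ℚ_[p]).comp dec.toLinearMap)
  /-- (9.1.1.4): `H¹_e = H¹_f` [BlochKato1990], p. 95 l. 47–49 -/
  He_eq_Hf : He = Hf
  /-- (9.1.1.4): `H¹_f ⊊ H¹_st`, p. 95 l. 49–50 -/
  Hf_lt_Hst : Hf < Hst
  /-- (9.1.1.4): `H¹_st = H¹_g`, p. 95 l. 50–51 -/
  Hst_eq_Hg : Hst = Hg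
  /-- (9.1.1.4): `H¹_g = H¹(G_E, ℚ_p(1))`, p. 95 l. 51 -/
  Hg_eq_top : Hg = ⊤

namespace BlochKatoDatum

variable {p E H1} (D : BlochKatoDatum p E H1)

/-- The «integral version» `H¹_∗(G_E, ℤ_p(1)) := H¹(G_E, ℤ_p(1)) ∩ H¹_∗(G_E, ℚ_p(1))` (p. 95 l. 36–39), read inside
`H¹(G_E, ℚ_p(1))`. [claim: Joshi2024ATS3, status: disputed] -/
def integral (H : Submodule ℚ_[p] H1) : AddSubgroup H1 := D.HZ ⊓ H.toAddSubgroup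

/-- Membership in the integral version. [claim: Joshi2024ATS3, status: disputed] -/
theorem mem_integral_iff (H : Submodule ℚ_[p] H1) (x : H1) : x ∈ D.integral H ↔ x ∈ D.HZ ∧ x ∈ H := AddSubgroup.mem_inf

/-- (9.1.1.4), integral level: `H¹_e(G_E, ℤ_p(1)) = H¹_f(G_E, ℤ_p(1))`. DERIVED. [claim: Joshi2024ATS3, status: disputed] -/
theorem integral_He_eq_integral_Hf : D.integral D.He = D.integral D.Hf := by rw [D.He_eq_Hf]

/-- (9.1.1.4) chained: `H¹_f ⊊ H¹(G_E, ℚ_p(1))`. DERIVED. [claim: Joshi2024ATS3, status: disputed] -/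
theorem Hf_lt_top : D.Hf < ⊤ := by
  have h := D.Hf_lt_Hst; rw [D.Hst_eq_Hg, D.Hg_eq_top] at h; exact h

/-- The identification `H¹(G_E, ℚ_p(1)) → E` of (9.1.1.3) (`κ(q) ↦ log_E(q)`). [claim: Joshi2024ATS3, status: disputed] -/
def toE : H1 →ₗ[ℚ_[p]] E := (LinearMap.fst ℚ_[p] E ℚ_[p]).comp D.dec.toLinearMap

/-- `toE x = (dec x).1`. [claim: Joshi2024ATS3, status: disputed] -/
@[simp] theorem toE_apply (x : H1) : D.toE x = (D.dec x).1 := rfl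

/-- A class lies in `H¹_f` iff its valuation component under (9.1.1.3) vanishes. [claim: Joshi2024ATS3, status: disputed] -/
theorem mem_Hf_iff (x : H1) : x ∈ D.Hf ↔ (D.dec x).2 = 0 := by
  rw [D.Hf_eq_ker, LinearMap.mem_ker]; rfl

/-- **DERIVED from (9.1.1.3)**: `κ(q) ∈ H¹_f(G_E, ℚ_p(1))` iff `v_E(q) = 0` («tracks the valuation of `q` separately»,
p. 95 l. 24–25). [claim: Joshi2024ATS3, status: disputed] -/
theorem kummer_mem_Hf_iff (q : Eˣ) : D.kummer q ∈ D.Hf ↔ D.val q = 0 := by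
  rw [D.mem_Hf_iff, D.dec_kummer]
  exact Int.cast_eq_zero

/-- … iff `q` is a unit (`‖q‖ = 1`): units have classes in the Bloch–Kato subspace, an element of nonzero valuation does
not. [claim: Joshi2024ATS3, status: disputed] -/
theorem kummer_mem_Hf_iff_norm (q : Eˣ) : D.kummer q ∈ D.Hf ↔ ‖(q : E)‖ = 1 := by
  rw [D.kummer_mem_Hf_iff, D.val_eq_zero_iff]

/-- The same for `H¹_e` (via (9.1.1.4)). [claim: Joshi2024ATS3, status: disputed] -/
theorem kummer_mem_He_iff_norm (q : Eˣ) : D.kummer q ∈ D.He ↔ ‖(q : E)‖ = 1 := by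
  rw [D.He_eq_Hf, D.kummer_mem_Hf_iff_norm]

/-- For a unit `u`, the `H¹_f`-component of `κ(u)` is `log_p(u) ∈ log_p(𝒪_E^×)` (OUR `logUnits E`).
[claim: Joshi2024ATS3, status: disputed] -/
theorem toE_kummer_mem_logUnits (u : Eˣ) (hu : ‖(u : E)‖ = 1) : D.toE (D.kummer u) ∈ logUnits E := by
  rw [D.toE_apply, D.dec_kummer, D.logE_of_norm_eq_one u hu]
  exact unitLog_mem_logUnits hu

end BlochKatoDatum

end BlochKato

/-! ## 2. §9.1.2 — the archimedean case -/

/-- (9.1.2.1) (p. 96 l. 6–16): at archimedean `v` (`L_v ≃ ℂ`; no real places, §3.1/§3.3)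
`H¹(L_v, ℤ(1)) := Ext¹_{ℤ-MHS}(ℤ(0), ℤ(1)) ≃ L_v^* ≃ ℂ^*`, «the archimedean analog of Galois cohomology» [Joshi 2023a, §10.10].
MODEL: the printed `≃ ℂ^*` is taken as the definition (the submonoid `{q ≠ 0}` of `ℂ`). [claim: Joshi2024ATS3, status: disputed] -/
def archH1 : Submonoid ℂ where
  carrier := {q | q ≠ 0}
  one_mem' := one_ne_zero
  mul_mem' := fun ha hb => mul_ne_zero ha hb

/-- (9.1.2.2) (p. 96 l. 17–26): «the archimedean Frobenius-invariant Bloch–Kato subspace», «the multiplicative submonoid of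
`ℂ^*` … `H¹_e(ℂ, ℤ(1)) = {q : 0 < |q|_ℂ ≤ 1} ⊂ H¹(ℂ, ℤ(1))`». DEFINED; the submonoid property is PROVED.
[claim: Joshi2024ATS3, status: disputed] -/
def archH1e : Submonoid ℂ where
  carrier := {q | 0 < ‖q‖ ∧ ‖q‖ ≤ 1}
  one_mem' := by simp
  mul_mem' := by
    rintro a b ⟨ha0, ha1⟩ ⟨hb0, hb1⟩
    refine ⟨?_, ?_⟩
    · show 0 < ‖a * b‖
      rw [Complex.norm_mul]; exact mul_pos ha0 hb0
    · show ‖a * b‖ ≤ 1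
      rw [Complex.norm_mul]; exact mul_le_one₀ ha1 hb0.le hb1

/-- Membership in `H¹_e(ℂ, ℤ(1))`. [claim: Joshi2024ATS3, status: disputed] -/
theorem mem_archH1e_iff (q : ℂ) : q ∈ archH1e ↔ 0 < ‖q‖ ∧ ‖q‖ ≤ 1 := Iff.rfl

/-- `H¹_e(ℂ, ℤ(1)) ⊂ H¹(ℂ, ℤ(1))` (p. 96 l. 26). DERIVED. [claim: Joshi2024ATS3, status: disputed] -/
theorem archH1e_le_archH1 : archH1e ≤ archH1 := fun _ hq => norm_pos_iff.1 hq.1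

/-- «if `q` is a Schottky parameter of an elliptic curve over `ℂ`, then `q ∈ H¹_e(ℂ, ℤ(1))`» (p. 96 l. 27–30) — PROVED for
`q = e^{2πiτ}`, `Im τ > 0`. [claim: Joshi2024ATS3, status: disputed] -/
theorem exp_two_pi_I_mul_mem_archH1e {τ : ℂ} (hτ : 0 < τ.im) : Complex.exp (2 * π * Complex.I * τ) ∈ archH1e := by
  rw [mem_archH1e_iff, Complex.norm_exp]
  have hre : (2 * (π : ℂ) * Complex.I * τ).re = -(2 * π * τ.im) := by simp [Complex.mul_re, Complex.mul_im]
  rw [hre]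
  exact ⟨Real.exp_pos _, Real.exp_le_one_iff.2 (by nlinarith [Real.pi_pos])⟩

/-! ## 3. Def. 9.2.1.1 — Mochizuki's log-shell à la Joshi; (9.2.1.3) the `ℚ_p`-log-shell -/

section MochizukiLogShell

variable (p : ℕ) (Lv : Type*) [NontriviallyNormedField Lv]

open Classical in
/-- **Def. 9.2.1.1** (p. 96 l. 35–50): for a holomorphoid `hol(X/L)_y` and `v ∈ V_L^non`, `v | p`, «the Mochizuki's log-shell given
by `hol(X/L)_y` at `v` is the `ℤ_p`-module» (9.2.1.2) `I((X/L_v, X^an/K_v)) = (1/p)·log(𝒪^*_{L_v}) ⊂ (1/p)·log(𝒪^*_{K_v})` if `p ≥ 3`,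
`(1/4)·log(𝒪^*_{L_v}) ⊂ (1/4)·log(𝒪^*_{K_v})` if `p = 2`. DEFINED verbatim by cases inside `L_v` (`log(𝒪^*_{L_v}) =` OUR
`logUnits L_v`); the ambient `(1/p)·log(𝒪^*_{K_v})` (`K_v` from the holomorphoid) is not typed (merge-debt E-t1/E-t5).
[claim: Joshi2024ATS3, status: disputed] -/
def mochizukiLogShell : Set Lv := if 3 ≤ p then (p : Lv)⁻¹ • logUnits Lv else (4 : Lv)⁻¹ • logUnits Lv

variable [Fact p.Prime] [NormedAlgebra ℚ_[p] Lv]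

/-- (9.2.1.3) (p. 96 l. 51–52): «the Mochizuki's `ℚ_p`-log-shell … `I^{ℚ_p} = I ⊗_{ℤ_p} ℚ_p`». MODEL: the `ℚ_p`-span of the lattice
`I` inside `L_v`. [claim: Joshi2024ATS3, status: disputed] -/
def mochizukiLogShellQ : Submodule ℚ_[p] Lv := Submodule.span ℚ_[p] (mochizukiLogShell p Lv)

variable [IsUltrametricDist Lv] [CompleteSpace Lv]

/-- **E3 DICTIONARY ROW** (Def. 9.2.1.1 ↔ [AbsTopIII] Def. 5.4 (iii) / [IUTchIII] Prop. 1.2 (vi)): Joshi's case formula IS OUR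
log-shell `ℐ = (p*)⁻¹ · log_p(𝒪^×)` of the standard model (`p* = p` for odd `p`, `= 4` for `p = 2`). PROVED.
[claim: Joshi2024ATS3, status: disputed] -/
theorem mochizukiLogShell_eq_logShell : mochizukiLogShell p Lv = logShell (PadicLogOnUnits.ofUnitLog p Lv) := by
  rw [logShell_ofUnitLog, mochizukiLogShell]
  by_cases h2 : p = 2
  · subst h2
    rw [if_neg (by norm_num), if_pos rfl]
    norm_num
  · have h3 : 3 ≤ p := by have := (Fact.out : p.Prime).two_le; omega
    rw [if_pos h3, if_neg h2, pow_one]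

/-- **Lemma 9.2.1.4, model level** (p. 96 l. 54 – p. 97 l. 3: «immediate from Mochizuki's definition of mono-analytic
log-shells»): `𝒪_{L_v} ⊆ I` ([AbsTopIII] Def. 5.4 (iii); [IUTchIII] Prop. 1.2 (v)(b)). DERIVED. [claim: Joshi2024ATS3, status: disputed] -/
theorem closedBall_subset_mochizukiLogShell : closedBall (0 : Lv) 1 ⊆ mochizukiLogShell p Lv := by
  rw [mochizukiLogShell_eq_logShell]; exact closedBall_subset_logShell_ofUnitLog p Lv

/-- `log_p(𝒪^×_{L_v}) ⊆ I` ([IUTchIII] Prop. 1.2 (v)(c): `log(u) = (p*)⁻¹·log(u^{p*})`). DERIVED. [claim: Joshi2024ATS3, status: disputed] -/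
theorem logUnits_subset_mochizukiLogShell [ProperSpace Lv] : logUnits Lv ⊆ mochizukiLogShell p Lv := by
  rw [mochizukiLogShell_eq_logShell, logShell_ofUnitLog]
  rintro _ ⟨u, hu, rfl⟩
  rw [mem_setOf_eq] at hu
  have hn : ‖u ^ (p ^ (if p = 2 then 2 else 1))‖ = 1 := by rw [norm_pow, hu, one_pow]
  have key : unitLog u = ((p ^ (if p = 2 then 2 else 1) : ℕ) : Lv)⁻¹ • unitLog (u ^ (p ^ (if p = 2 then 2 else 1))) := by
    rw [unitLog_pow p hu, smul_eq_mul, inv_mul_cancel_left₀ (pstarNat_cast_ne_zero p Lv)]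
  rw [key]
  exact Set.smul_mem_smul_set (unitLog_mem_logUnits hn)

/-- **(9.2.1.3), DERIVED**: the `ℚ_p`-log-shell is all of `L_v` (OUR «`I^ℚ`»/`log(D⊢_v)` carrier). [claim: Joshi2024ATS3, status: disputed] -/
theorem mochizukiLogShellQ_eq_top : mochizukiLogShellQ p Lv = ⊤ := by
  refine Submodule.eq_top_iff'.2 fun x => ?_
  have hp1 : (1 : ℝ) < p := by exact_mod_cast (Fact.out : p.Prime).one_lt
  have hlt : ‖(p : ℚ_[p])‖ < 1 := by rw [Padic.norm_p]; exact inv_lt_one_of_one_lt₀ hp1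
  obtain ⟨n, hn⟩ := exists_pow_lt_of_lt_one (show (0 : ℝ) < 1 / (‖x‖ + 1) by positivity) hlt
  have hn' : ‖(p : ℚ_[p])‖ ^ n * ‖x‖ ≤ 1 := by
    calc ‖(p : ℚ_[p])‖ ^ n * ‖x‖ ≤ (1 / (‖x‖ + 1)) * (‖x‖ + 1) := by gcongr; linarith
      _ = 1 := by field_simp
  have hc : ((p : ℚ_[p]) ^ n) ≠ 0 := pow_ne_zero _ (by exact_mod_cast (Fact.out : p.Prime).ne_zero)
  have hmem : ((p : ℚ_[p]) ^ n) • x ∈ mochizukiLogShellQ p Lv := by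
    refine Submodule.subset_span (closedBall_subset_mochizukiLogShell p Lv ?_)
    rw [mem_closedBall, dist_zero_right, norm_smul, norm_pow]; exact hn'
  rw [← inv_smul_smul₀ hc x]
  exact Submodule.smul_mem _ _ hmem

end MochizukiLogShell

/-! ## 4. Prop. 9.2.1.5 -/

section Prop9215

/-- **«amphoric»** as USED in [J-III] (p. 94 l. 43–45; Rmk. 9.4.8.2 p. 105 l. 53–55: «By Proposition 9.2.1.5 the log-shells are
amphoric. Hence one has abstract isomorphisms `I_{p,y_j} ≃ I_{p,y_ℓ*}`»): a quantity `M ω` attached to data `ω` (a `p`-adic field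
with closure / a holomorphoid) is amphoric if data related by `galIso` («isomorphic Galois / tempered groups») carry isomorphic
`M`. (Print's notion [Joshi 2020a] is reconstruction from the group — OUR functorial typing: [AbsTopIII] Prop. 5.8,
`Literature.AnabelianGeometry.AbsoluteAnabelian.MonoAnalyticNonarchAlgorithmModel`.) [claim: Joshi2024ATS3, status: disputed] -/
def IsAmphoric {Ω : Type*} (galIso : Ω → Ω → Prop) (M : Ω → Type*) [∀ ω, AddCommGroup (M ω)] : Prop :=
  ∀ ω₁ ω₂, galIso ω₁ ω₂ → Nonempty (M ω₁ ≃+ M ω₂)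

/-- **Prop. 9.2.1.5 (1), (2)** (p. 97 l. 6–18): «(1) `I((X/L_v, X^an/K_v))` is a `Π^temp_{X/L_v;K_v}`-amphoric (and hence also
`G_{L_v;K_v}`-amphoric) `ℤ_p`-module. (2) `I^{ℚ_p}((X/L_v, X^an/K_v))` and `H¹_e(G_{L_v;K_v}, ℚ_p(1))` are … amphoric … `ℚ_p` vector
spaces», over a family `ω ↦ (I ω, IQ ω, He ω)`. HYPOTHESIS. [claim: Joshi2024ATS3, status: disputed] -/
@[claim "Joshi2024ATS3" "disputed"]
def LogShellAmphoric {Ω : Type*} (galIso : Ω → Ω → Prop) (I IQ He : Ω → Type*) [∀ ω, AddCommGroup (I ω)]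
    [∀ ω, AddCommGroup (IQ ω)] [∀ ω, AddCommGroup (He ω)] : Prop :=
  IsAmphoric galIso I ∧ IsAmphoric galIso IQ ∧ IsAmphoric galIso He

variable {p : ℕ} [Fact p.Prime] {E : Type} [NontriviallyNormedField E] [NormedAlgebra ℚ_[p] E]
variable {H1 : Type} [AddCommGroup H1] [Module ℚ_[p] H1] (D : BlochKatoDatum p E H1)

/-- **Prop. 9.2.1.5 (3)** (p. 97 l. 19–26), `E = L_v`: «`I((X/L_v, X^an/K_v)) = H¹_f(G_{L_v;K_v}, ℤ_p(1)) = H¹_e(G_{L_v;K_v}, ℤ_p(1))`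
and `I^{ℚ_p}(…) = H¹_f(…, ℚ_p(1)) = H¹_e(…, ℚ_p(1))`» — typed: the identification (9.1.1.3) carries the integral `H¹_f`-classes
ONTO `I` and `H¹_f(ℚ_p(1))` ONTO `I^{ℚ_p}` (the `e = f` halves: `integral_He_eq_integral_Hf`, `He_eq_Hf`); (4) («integral (resp.
rational) Frobenius-invariant … classes», l. 27–28) is (3) read through `H¹_e`. HYPOTHESIS — see `toE_kummer_mem_mochizukiLogShell`,
`Hf_map_toE_eq` for what the signature gives. [claim: Joshi2024ATS3, status: disputed] -/
@[claim "Joshi2024ATS3" "disputed"]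
def LogShellIsBlochKato : Prop :=
  D.toE '' (D.integral D.Hf : Set H1) = mochizukiLogShell p E ∧ D.Hf.map D.toE = mochizukiLogShellQ p E

/-- DERIVED toward (3)/(4), no judgement: the image of the Kummer class of a UNIT `u` is `log_p(u) ∈ I = (1/p*)·log_p(𝒪^×)`.
[claim: Joshi2024ATS3, status: disputed] -/
theorem toE_kummer_mem_mochizukiLogShell [IsUltrametricDist E] [CompleteSpace E] [ProperSpace E] (u : Eˣ)
    (hu : ‖(u : E)‖ = 1) : D.toE (D.kummer u) ∈ mochizukiLogShell p E :=
  logUnits_subset_mochizukiLogShell p E (D.toE_kummer_mem_logUnits u hu)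

/-- DERIVED: the rational half of (3) holds in the model (`toE` maps `H¹_f = E ⊕ 0` onto `L_v = I^{ℚ_p}`).
[claim: Joshi2024ATS3, status: disputed] -/
theorem Hf_map_toE_eq [IsUltrametricDist E] [CompleteSpace E] : D.Hf.map D.toE = mochizukiLogShellQ p E := by
  rw [mochizukiLogShellQ_eq_top]
  refine Submodule.eq_top_iff'.2 fun y => Submodule.mem_map.2 ⟨D.dec.symm (y, 0), ?_, ?_⟩
  · rw [D.mem_Hf_iff, LinearEquiv.apply_symm_apply]
  · rw [D.toE_apply, LinearEquiv.apply_symm_apply]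

end Prop9215

/-! ## 5. §9.2.2 — adelic log-shells -/

section Adelic

variable {V : Type*} (pOf : V → ℕ) (Lv : V → Type*) [∀ v, NontriviallyNormedField (Lv v)]

/-- **Def. 9.2.2.1** (p. 98 l. 1–7): «Mochizuki's adelic log-shell is the topological group (with product topology)
`𝓘(hol(X/L)_y) = ∏_{v ∈ V_L} I(hol(X/L_v)_{y_v})`» — the product SET over places `V` with residue characteristics `pOf` and local
fields `Lv` (Def. 9.2.1.1 defines the factor only at `v | p < ∞`: READ over the nonarchimedean places; the archimedean objects
are §9.1.2). [claim: Joshi2024ATS3, status: disputed] -/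
def adelicLogShell : Set (∀ v, Lv v) := Set.pi Set.univ fun v => mochizukiLogShell (pOf v) (Lv v)

/-- Membership in the adelic log-shell is componentwise. [claim: Joshi2024ATS3, status: disputed] -/
theorem mem_adelicLogShell_iff (x : ∀ v, Lv v) :
    x ∈ adelicLogShell pOf Lv ↔ ∀ v, x v ∈ mochizukiLogShell (pOf v) (Lv v) := by
  simp [adelicLogShell]

variable [∀ v, Fact (pOf v).Prime] [∀ v, NormedAlgebra ℚ_[pOf v] (Lv v)]

/-- (9.2.2.3) (p. 98 l. 7–11): «Mochizuki's rational adelic log-shell `𝓘^ℚ(hol(X/L)_y) = ∏_{v} I^{ℚ_{p_v}}(hol(X/L_v)_{y_v})`».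
[claim: Joshi2024ATS3, status: disputed] -/
def adelicLogShellQ : Set (∀ v, Lv v) := Set.pi Set.univ fun v => (mochizukiLogShellQ (pOf v) (Lv v) : Set (Lv v))

/-- DERIVED: in the model the rational adelic log-shell is the full product. [claim: Joshi2024ATS3, status: disputed] -/
theorem adelicLogShellQ_eq_univ [∀ v, IsUltrametricDist (Lv v)] [∀ v, CompleteSpace (Lv v)] :
    adelicLogShellQ pOf Lv = Set.univ := by
  simp [adelicLogShellQ, mochizukiLogShellQ_eq_top]

/-- **Prop. 9.2.2.4** (p. 98 l. 12–19): «the following identification of Mochizuki's adelic log-shell and … rational adelic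
log-shell: (9.2.2.5) `𝓘(hol(X/L)_y) [≅] H¹(arith(L)_y, Ẑ(1))`, `𝓘^ℚ(hol(X/L)_y) [≅] H¹_e(arith(L)_y, ℚ(1))`» («immediate from the
definition of the adelic cohomology of an arithmeticoid [Joshi 2023a, §7] and Proposition 9.2.1.5»). RENDER NOTE: the relation
symbols (and a possible subscript on the first `H¹`) are lost in the text layer, p. 98 l. 14–17; typed, per the sentence and
the proof, as the COMPONENTWISE identification (3) over a family of local Bloch–Kato data (adelic cohomology = product of the
local groups, cf. Def. 9.4.2.3 p. 101 l. 20–32). HYPOTHESIS. [claim: Joshi2024ATS3, status: disputed] -/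
@[claim "Joshi2024ATS3" "disputed"]
def AdelicLogShellIsBlochKato {Lv' : V → Type} [∀ v, NontriviallyNormedField (Lv' v)] [∀ v, NormedAlgebra ℚ_[pOf v] (Lv' v)]
    (H1 : V → Type) [∀ v, AddCommGroup (H1 v)] [∀ v, Module ℚ_[pOf v] (H1 v)]
    (D : ∀ v, BlochKatoDatum (pOf v) (Lv' v) (H1 v)) : Prop :=
  ∀ v, LogShellIsBlochKato (D v)

end Adelic

end Summit.ABC.IUTFork.Joshi

end
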